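import Summits.CriticalPhenomena.Ising3D.TaylorCertificateOddOfLt
import Summits.CriticalPhenomena.Ising3D.TaylorCertificateRegion
import Mathlib.Tactic.Linarith
import Mathlib.Tactic.Positivity
import Mathlib.Tactic.Ring
import HarnessLib

/-!
# The TERMWISE obligation list of a derivative-functional certificate, and `BoxExcluded` from it
(cell `pub-ising3x`, seat boot-1; the normative Lean statement a kind-`deriv` certificate format must discharge —
the derivative analogue of `boxExcluded_of_mixedPointTable₂`'s role for kind `points`, one level up: cells are
given by head sets and termwise inequalities, not yet by rational tables)

HONEST FRAMING: lottery ticket; floor = tightest certified 3D Ising CFT bounds; no exact-solution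
claim without a proof.

`TaylorTermwiseObligations α Q E₀` (a `Prop` structure): (I) the identity term is positive on `Q`;
(E) for every even-sector cell `(Δ, ℓ)` below `E₀` allowed by A1/A4 (admissible point; scalars below 3 only
at `Δε`) a finite head set `F` with the head form `≥ 0` and PSD tail terms; (E5) the coefficient-free cone
region `TaylorEvenRegion α Q E₀`; (D) for every odd-sector cell strictly above the bound and below `E₀`
(scalars below 3 only at `Δσ`) a head set with head `≥ 0` and non-negative tail term values; (D5) the
dominated termwise inequality on the odd tail. THEOREM `boxExcluded_of_taylorTermwiseObligations`: for `α`
Taylor at a diagonal point `(x,x)`, `E₀ > 1`, and `Q ⊆ {½ < Δσ < 1, Δε > Δσ + ½}` these give `BoxExcluded Q`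
(via the tree's `MixedObligations`, the termwise rules of `TaylorCertificateTermwise/OddOfLt/Region`, the
vacuity of odd cells AT the bound, and T4-A `boxExcluded_of_mixedObligations_taylor`). What is NOT here: the
rational TABLE (interval / Taylor-model evaluation of the closed forms of `TaylorCoeffZMonoHalf` over
Δ-cells) — the next layer down — and (g1), which is where `odd_cell`'s tail condition is hard near the
leading odd twist. Sources: Kos–Poland–Simmons-Duffin 2014 §3.3 eq. (3.16).
-/

namespace Summit.CriticalPhenomena.Ising3D

open Finset Set
open Literature.MathematicalPhysics.QuantumFieldTheory.ConformalBootstrap3D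

/-- **Termwise obligations of a derivative (`Taylor`) certificate** for `α⃗`, a set `Q` of external
dimensions and a head threshold `E₀`. [cite: KosPolandSimmonsduffin2014, §3.3 eq. (3.16)] -/
structure TaylorTermwiseObligations (α : CrossingFunctional) (Q : Set (ℝ × ℝ)) (E₀ : ℝ) : Prop where
  /-- (I) the identity term is positive on `Q`. -/
  identity_pos : ∀ p ∈ Q, 0 < α.identityTerm p.1 p.2
  /-- (E) even-sector cells below `E₀`: head set + PSD tail terms. -/
  even_cell : ∀ p ∈ Q, ∀ (ℓ : ℕ) (Δ : ℝ), Even ℓ → IsAdmissible3D Δ ℓ → Δ < E₀ →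
    (ℓ = 0 → Δ < 3 → Δ = p.2) →
    ∃ F : Finset (ℕ × ℕ),
      (∀ a b : ℝ, 0 ≤ ∑ q ∈ F, hrCoeff Δ ℓ q.1 q.2 / legendreLam ℓ *
        α.evenForm p.1 p.2 (zMono (Δ + (q.1 : ℝ)) q.2) a b) ∧
      (∀ q : ℕ × ℕ, q ∉ F → InDescendantRange ℓ q.1 q.2 →
        ∀ a b : ℝ, 0 ≤ α.evenForm p.1 p.2 (zMono (Δ + (q.1 : ℝ)) q.2) a b)
  /-- (E5) the even tail: the coefficient-free cone region. -/
  even_region : TaylorEvenRegion α Q E₀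
  /-- (D) odd-sector cells strictly above the bound and below `E₀`: head set + non-negative tail values. -/
  odd_cell : ∀ p ∈ Q, ∀ (ℓ : ℕ) (Δ : ℝ), unitarityBound3D ℓ < Δ → Δ < E₀ →
    (ℓ = 0 → Δ < 3 → Δ = p.1) →
    ∃ F : Finset (ℕ × ℕ), 0 ≤ ∑ q ∈ F, oddTermValue α p.1 p.2 Δ ℓ q ∧
      ∀ q : ℕ × ℕ, q ∉ F → 0 ≤ oddTermValue α p.1 p.2 Δ ℓ q
  /-- (D5) the odd tail: the dominated termwise inequality at every `(Δ, ℓ, n, j)` beyond `E₀`. -/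
  odd_tail : ∀ p ∈ Q, ∀ (ℓ : ℕ) (Δ : ℝ), unitarityBound3D ℓ < Δ → E₀ ≤ Δ → ∀ q : ℕ × ℕ,
    InDescendantRange ℓ q.1 q.2 →
    (hrCoeffAB ((p.1 - p.2) / 2) ((p.1 - p.2) / 2) Δ ℓ q.1 q.2 / legendreLam ℓ +
          hrCoeffAB (-(p.1 - p.2) / 2) (-(p.1 - p.2) / 2) Δ ℓ q.1 q.2 / legendreLam ℓ) / 2 *
        |α.α₃ (crossF ((p.1 + p.2) / 2) (-1) (zMono (Δ + (q.1 : ℝ)) q.2))| ≤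
      hrCoeffAB ((p.1 - p.2) / 2) ((p.1 - p.2) / 2) Δ ℓ q.1 q.2 / legendreLam ℓ *
        (α.α₄ (crossF p.1 (-1) (zMono (Δ + (q.1 : ℝ)) q.2)) -
          α.α₅ (crossF p.1 1 (zMono (Δ + (q.1 : ℝ)) q.2)))

/-- **The termwise obligations give the tree's obligation list** `MixedObligations α Q E₀` (hence
`IsPositiveAt` on `Q`), for `α` Taylor at a diagonal point, `E₀ > 1`, `Q ⊆ {½ < Δσ < 1, Δε > Δσ + ½}`.
[cite: KosPolandSimmonsduffin2014, §3.3 eq. (3.16)] -/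
theorem mixedObligations_of_taylorTermwiseObligations {x : ℝ} (hx0 : 0 < x) (hx1 : x < 1)
    (α : CrossingFunctional) (hα : IsTaylorAt α x x) {Q : Set (ℝ × ℝ)} {E₀ : ℝ} (hE₀ : 1 < E₀)
    (hQ : ∀ p ∈ Q, 1 / 2 < p.1 ∧ p.1 < 1 ∧ p.1 + 1 / 2 < p.2) (h : TaylorTermwiseObligations α Q E₀) :
    MixedObligations α Q E₀ := by
  have hb0 : unitarityBound3D 0 = 1 / 2 := by simp [unitarityBound3D]
  have hbℓ : ∀ ℓ : ℕ, ℓ ≠ 0 → unitarityBound3D ℓ = (ℓ : ℝ) + 1 := fun ℓ hℓ => by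
    unfold unitarityBound3D; rw [if_neg hℓ]
  -- even cells via the termwise rule
  have heven : ∀ p ∈ Q, ∀ (ℓ : ℕ) (Δ : ℝ), Even ℓ → IsAdmissible3D Δ ℓ → Δ < E₀ →
      (ℓ = 0 → Δ < 3 → Δ = p.2) → α.EvenPositive p.1 p.2 Δ ℓ := by
    intro p hp ℓ Δ hev hadm hE hgap
    obtain ⟨F, hhead, htail⟩ := h.even_cell p hp ℓ Δ hev hadm hE hgap
    exact evenPositive_of_isTaylorAt_of_termwise hx0 hx1 α hα hadm F hhead htail
  -- odd cells strictly above the bound via the termwise rule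
  have hodd : ∀ p ∈ Q, ∀ (ℓ : ℕ) (Δ : ℝ), unitarityBound3D ℓ < Δ → Δ < E₀ →
      (ℓ = 0 → Δ < 3 → Δ = p.1) → α.OddPositive p.1 p.2 Δ ℓ := by
    intro p hp ℓ Δ hlt hE hgap
    obtain ⟨h1q, h2q, _⟩ := hQ p hp
    have h1 : ℓ = 0 → Δ ≠ 1 := by
      intro hℓ hΔ
      by_cases h3 : Δ < 3
      · have := hgap hℓ h3; rw [hΔ] at this; linarith
      · linarith
    obtain ⟨F, hhead, htail⟩ := h.odd_cell p hp ℓ Δ hlt hE hgap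
    exact oddPositive_of_isTaylorAt_of_termwise_of_lt hx0 hx1 α hα hlt h1 F hhead htail
  refine ⟨h.identity_pos, ?_, ?_, ?_, ?_, ?_, ?_, ?_, ?_⟩
  · -- (E2) ε itself
    intro p hp
    obtain ⟨h1q, _, h3q⟩ := hQ p hp
    by_cases hE : p.2 < E₀
    · refine heven p hp 0 p.2 (by decide) ⟨by rw [hb0]; linarith, fun _ => by rw [hb0]; linarith⟩ hE
        (fun _ _ => rfl)
    · rw [not_lt] at hE
      exact tail_even_of_taylorEvenRegion hx0 hx1 α hα (by linarith) h.even_region p hp 0 (by decide) p.2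
        (by rw [hb0]; linarith) hE
  · -- (E3) even scalars 3 ≤ Δ < E₀
    intro p hp Δ h3 hE
    exact heven p hp 0 Δ (by decide) ⟨by rw [hb0]; linarith, fun _ => by rw [hb0]; linarith⟩ hE
      (fun _ h => absurd h (not_lt.mpr h3))
  · -- (E4) even spins ℓ ≠ 0, ℓ+1 ≤ Δ < E₀
    intro p hp ℓ hev hℓ Δ hb hE
    exact heven p hp ℓ Δ hev ⟨by rw [hbℓ ℓ hℓ]; exact hb, fun h => absurd h hℓ⟩ hE
      (fun h => absurd h hℓ)
  · -- (E5) even tail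
    exact tail_even_of_taylorEvenRegion hx0 hx1 α hα (by linarith) h.even_region
  · -- (D2) σ itself
    intro p hp
    obtain ⟨h1q, h2q, _⟩ := hQ p hp
    have hE : p.1 < E₀ := by linarith
    exact hodd p hp 0 p.1 (by rw [hb0]; exact h1q) hE (fun _ _ => rfl)
  · -- (D3) odd scalars 3 ≤ Δ < E₀
    intro p hp Δ h3 hE
    exact hodd p hp 0 Δ (by rw [hb0]; linarith) hE (fun _ h => absurd h (not_lt.mpr h3))
  · -- (D4) odd spins ℓ ≠ 0, ℓ+1 ≤ Δ < E₀: at the bound vacuous, above it termwise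
    intro p hp ℓ hℓ Δ hb hE
    obtain ⟨_, _, h3q⟩ := hQ p hp
    rcases hb.lt_or_eq with hlt | heq
    · exact hodd p hp ℓ Δ (by rw [hbℓ ℓ hℓ]; exact hlt) hE (fun h => absurd h hℓ)
    · rw [← heq]
      exact oddPositive_bound_of_ne α (by linarith) (Nat.one_le_iff_ne_zero.mpr hℓ)
  · -- (D5) odd tail
    exact tail_odd_of_dominated hx0 hx1 α hα hE₀ (fun p hp => by
      obtain ⟨_, _, h3q⟩ := hQ p hp; linarith) h.odd_tail

/-- **Box exclusion from the termwise obligations of a derivative certificate.**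
[cite: KosPolandSimmonsduffin2014, §3.3 eq. (3.16)] -/
theorem boxExcluded_of_taylorTermwiseObligations {x : ℝ} (hx0 : 0 < x) (hx1 : x < 1)
    (α : CrossingFunctional) (hα : IsTaylorAt α x x) {Q : Set (ℝ × ℝ)} {E₀ : ℝ} (hE₀ : 1 < E₀)
    (hQ : ∀ p ∈ Q, 1 / 2 < p.1 ∧ p.1 < 1 ∧ p.1 + 1 / 2 < p.2) (h : TaylorTermwiseObligations α Q E₀) :
    BoxExcluded Q :=
  boxExcluded_of_mixedObligations_taylor hx0 hx1 α hα (fun p hp => ⟨(hQ p hp).2.1, (hQ p hp).2.2⟩)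
    (mixedObligations_of_taylorTermwiseObligations hx0 hx1 α hα hE₀ hQ h)

end Summit.CriticalPhenomena.Ising3D
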